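import Mathlib.MeasureTheory.Integral.Bochner.Set
import Literature.Probability.Percolation.AnchoredProfileGrowth
import Literature.Probability.Percolation.SiteConnectionTools
import Literature.Probability.Percolation.HalfSpaceProofs
import Literature.Probability.Percolation.HalfSpaceHighDim
import HarnessLib

/-!
# Cerf–Dembin 2020, proof of Theorem 1.2, III: the probabilistic half; Theorem 1.2 on `ℤ²`, `ℤ³`

Topic: `Literature/Probability/Percolation`. Third proof file (the sequel announced in
`AnchoredProfileExploration.lean` under the name `AnchoredIsoperimetricProfileProofs.lean`, which is
taken by the elementary layer of the profile) of the named fact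
`Literature.Probability.Percolation.CerfDembin2020_thm12` (`AnchoredIsoperimetricProfile.lean`;
R. Cerf, B. Dembin, *Vanishing of the anchored isoperimetric profile in bond percolation at `p_c`*,
Electron. Commun. Probab. 25 (2020), arXiv:1903.08065, Theorem 1.2: a.s.
`liminf_n n φ̂_n(p_c) = 0`, `d ≥ 2`). Following the printed proof (§2):

* `card_face_le` — a face `{x ∈ Λ(n) : x_i = v}` of the box has at most `(2n+1)^{d-1}` vertices
  ("`|({-n} × [-n,n]^{d-1}) ∩ ℤ^d|`");
* `real_mem_boxCluster_le` — for `x` on a face of `Λ(m+1)`,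
  `P(x ↔ 0 inside Λ(m+1)) ≤ P(0 ↔ Λ(m)ᶜ inside ℍ)`: a translation and a signed coordinate
  permutation of `ℤ^d` (which preserve `P_p`) carry `x` to `0`, the box into the half-space
  `ℍ = {x_0 ≥ 0}` and `0` to a point outside `Λ(m)` (printed: the bound of `E(X_n)` by
  `(2n+1)^{d-1} P(∃ γ open from 0 in ℕ × ℤ^{d-1}, |γ| ≥ n)` "using the symmetry of the lattice");
* `tendsto_real_exitBox` — `P(0 ↔ Λ(m)ᶜ inside ℍ) → θ_ℍ(p)` as `m → ∞` (continuity from above; the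
  events decrease to `{0 ↔ ∞ in ℍ}`, whose probability is `θ_ℍ(p)` by
  `theta_induce_eq_real_percolatesVia`), hence `→ 0` when `θ_ℍ(p) = 0`;
* `measure_bad_eq_zero` — for fixed `c > 0`, `N ≥ 2`: the event "every valid `H` with
  `|H| ≤ n^d`, `n ≥ N`, has `c|H| < n|∂°H|`" is null: it forces `γ n^d < n X_n` for all `n ≥ N`
  (`CerfDembin.boundary_lower_bound`, files I–II), while Markov's inequality and the two previous
  items give `γ n^d P(γ n^d ≤ n X_n) ≤ E(n X_n) ≤ 2d 3^{d-1} n^d P(0 ↔ Λ(n-1)ᶜ in ℍ) → 0` (printed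
  displays (eq1), (eq2) and the final contradiction with (eqabs));
* `ae_vanishing_of_theta_halfSpace` — hence, for every `p` with `θ_ℍ(p) = 0`, `P_p`-a.s. the
  `ε`–`N` form of `liminf_n n φ̂_n = 0` (countably many `c = 1/(k+1)` and `N`).

The theorem needs "no percolation in the half-space at `p_c(ℤ^d)`" (Barsky–Grimmett–Newman 1991
with Grimmett–Marstrand's `p_c(ℍ) = p_c`), which is the tree's named fact
`BarskyGrimmettNewman1991` (`HalfSpace.lean`), PROVED in the tree for `d = 2`
(`BarskyGrimmettNewman1991_dim_two`) and `d = 3` (`BarskyGrimmettNewman1991_Z3_holds`) and open in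
the tree for `d ≥ 4`. The general assemblies `CerfDembin2020_thm12_of_theta_halfSpace` (Theorem 1.2
in dimension `d` from `θ_ℍ(p_c(ℤ^d)) = 0`) and
`CerfDembin2020_thm12_of_BGN : BarskyGrimmettNewman1991 → CerfDembin2020_thm12` are those of the
parallel formalisation `AnchoredProfileVanishing.lean` (which counts the inner vertex boundary of
the box instead of its faces); this file completes the face-by-face variant of files I–II
(`AnchoredProfileExploration.lean`, `AnchoredProfileGrowth.lean`) and lands the UNCONDITIONAL
instances

* `CerfDembin2020_thm12_dim_two`, `CerfDembin2020_thm12_dim_three` (and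
  `CerfDembin2020_thm12_of_le_three`) — Theorem 1.2 for `d = 2` and `d = 3` (the case `d = 3` is
  the one used by the routes towards `θ(p_c) = 0` on `ℤ³`).

`CerfDembin2020_thm12_holds` itself (all `d ≥ 2`) is `CerfDembin2020_thm12_of_BGN` applied to
`BarskyGrimmettNewman1991_holds` once the latter lands.

## References

* R. Cerf, B. Dembin, ECP 25 (2020), paper no. 19, arXiv:1903.08065, doi:10.1214/19-ECP281, §2,
  proof of Theorem 1.2.
* D. J. Barsky, G. R. Grimmett, C. M. Newman, PTRF 90 (1991) 111–148; G. R. Grimmett,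
  J. M. Marstrand, Proc. Roy. Soc. London A 430 (1990) 439–457 (the half-space input).
-/

noncomputable section

namespace Literature.Probability.Percolation

open _root_.MeasureTheory _root_.Filter LatticeModels Finset
open scoped Classical _root_.Topology

namespace CerfDembin

/-! ## Faces of boxes -/

/-- A face `{x ∈ Λ(n) : x_i = v}` of the box `Λ(n) ⊆ ℤ^{e+1}` has at most `(2n+1)^e` vertices.
[folklore] -/
theorem card_face_le (e n : ℕ) (i : Fin (e + 1)) (v : ℤ) :
    #((box (e + 1) n).filter fun x => x i = v) ≤ (2 * n + 1) ^ e := by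
  have hsub : ((box (e + 1) n).filter fun x => x i = v) ⊆
      Fintype.piFinset (Function.update (fun _ : Fin (e + 1) => Finset.Icc (-(n : ℤ)) n) i {v}) := by
    intro x hx
    rw [mem_filter, mem_box] at hx
    rw [Fintype.mem_piFinset]
    intro j
    by_cases hj : j = i
    · subst hj; rw [Function.update_self, mem_singleton]; exact hx.2
    · rw [Function.update_of_ne hj, Finset.mem_Icc]; exact hx.1 j
  refine (card_le_card hsub).trans ?_
  rw [Fintype.card_piFinset]
  have hIcc : #(Finset.Icc (-(n : ℤ)) n) = 2 * n + 1 := by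
    rw [Int.card_Icc]; omega
  have : ∀ j, #(Function.update (fun _ : Fin (e + 1) => Finset.Icc (-(n : ℤ)) n) i {v} j) =
      Function.update (fun _ : Fin (e + 1) => 2 * n + 1) i 1 j := by
    intro j
    by_cases hj : j = i
    · subst hj; simp
    · rw [Function.update_of_ne hj, Function.update_of_ne hj, hIcc]
  rw [Finset.prod_congr rfl fun j _ => this j, prod_update_of_mem (mem_univ i), one_mul,
    prod_const, Finset.card_univ_sdiff, card_singleton, Fintype.card_fin, Nat.add_sub_cancel]

/-! ## Transfer to the half-space by a lattice symmetry -/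

/-- **From a face of the box to the half-space.** If `x` lies on the hyperplane
`x_i = u (m+1)` (`u = ±1`) of a face of `Λ(m+1)`, then
`P_p(x ↔ 0 inside Λ(m+1)) ≤ P_p(∃ y ∉ Λ(m), 0 ↔ y inside ℍ)`, `ℍ = {y_0 ≥ 0}`: the lattice
automorphism `y ↦ σ(y - x)` (`σ` the signed coordinate permutation exchanging the axes `i`, `0`
with sign `-u` on the new axis `0`) preserves `P_p`, maps `x ↦ 0`, `Λ(m+1)` into `ℍ`, and
`0 ↦ σ(-x) ∉ Λ(m)`. [cite: CerfDembin2020, §2 (proof of Thm. 1.2, bound (eq1) and "the symmetry of the lattice")] -/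
theorem real_mem_boxCluster_le (e m : ℕ) (p : unitInterval) (i : Fin (e + 1)) (u : ℤˣ)
    {x : Site (e + 1)} (hxi : x i = u * ((m + 1 : ℕ) : ℤ)) :
    (bondPercolation (zdGraph (e + 1)) p).real
        {ω | x ∈ openClusterIn (withinGraph (zdGraph (e + 1)) ↑(box (e + 1) (m + 1))) ω 0} ≤
      (bondPercolation (zdGraph (e + 1)) p).real
        {ω | ∃ y ∈ openClusterIn (withinGraph (zdGraph (e + 1)) (halfSpace (e + 1))) ω 0,
          y ∉ box (e + 1) m} := by
  set τ : zdGraph (e + 1) ≃g zdGraph (e + 1) :=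
    { toEquiv := Site.shift (-x), map_rel_iff' := fun {a b} => zdGraph_adj_shift_iff (-x) a b }
    with hτ
  set σ : zdGraph (e + 1) ≃g zdGraph (e + 1) :=
    zdSignedPermIso (Equiv.swap i 0) (Function.update 1 0 (-u)) with hσ
  set φ : zdGraph (e + 1) ≃g zdGraph (e + 1) := τ.trans σ with hφ
  have hφapply : ∀ y, φ y = Site.signedPerm (Equiv.swap i 0) (Function.update 1 0 (-u)) (y + -x) :=
    fun y => rfl
  have hu : (u : ℤ) = 1 ∨ (u : ℤ) = -1 := by
    rcases Int.units_eq_one_or u with h | h <;> simp [h]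
  have hφx : φ x = 0 := by
    rw [hφapply, add_neg_cancel, Site.signedPerm_zero]
  have hφ0 : φ 0 ∉ box (e + 1) m := by
    rw [hφapply, zero_add, signedPerm_mem_box_iff, mem_box, not_forall]
    refine ⟨i, ?_⟩
    rw [Pi.neg_apply, hxi]
    push_cast
    rcases hu with h | h <;> rw [h] <;> omega
  have himg : φ '' (↑(box (e + 1) (m + 1)) : Set (Site (e + 1))) ⊆ halfSpace (e + 1) := by
    rintro _ ⟨y, hy, rfl⟩
    rw [Finset.mem_coe, mem_box] at hy
    have hyi := hy i
    change 0 ≤ (φ y) 0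
    rw [hφapply, Site.signedPerm_apply, Equiv.symm_swap, Equiv.swap_apply_right,
      Function.update_self, Pi.add_apply, Pi.neg_apply, hxi]
    push_cast at hyi ⊢
    rcases hu with h | h <;> rw [h] <;> push_cast <;> nlinarith
  have hK : ∀ a b, (withinGraph (zdGraph (e + 1)) (φ '' ↑(box (e + 1) (m + 1)))).Adj
      (φ.toEquiv a) (φ.toEquiv b) ↔ (withinGraph (zdGraph (e + 1)) ↑(box (e + 1) (m + 1))).Adj a b := by
    intro a b
    simp only [withinGraph_adj, RelIso.coe_fn_toEquiv, φ.map_rel_iff, φ.injective.mem_set_image]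
  have hsub : {ω | x ∈ openClusterIn (withinGraph (zdGraph (e + 1)) ↑(box (e + 1) (m + 1))) ω 0} ⊆
      BondConfig.relabel (sym2Equiv φ.toEquiv) ⁻¹'
        {ω | ∃ y ∈ openClusterIn (withinGraph (zdGraph (e + 1)) (halfSpace (e + 1))) ω 0,
          y ∉ box (e + 1) m} := by
    intro ω hω
    rw [Set.mem_setOf_eq] at hω
    rw [Set.mem_preimage, Set.mem_setOf_eq]
    have h1 := openClusterIn_relabel φ.toEquiv hK ω 0
    have h2 : (0 : Site (e + 1)) ∈ openClusterIn (withinGraph (zdGraph (e + 1))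
        (φ '' ↑(box (e + 1) (m + 1)))) (BondConfig.relabel (sym2Equiv φ.toEquiv) ω) (φ.toEquiv 0) := by
      rw [h1]
      exact ⟨x, hω, hφx⟩
    have h3 := openClusterIn_eq_of_mem h2
    have h4 : φ.toEquiv 0 ∈ openClusterIn (withinGraph (zdGraph (e + 1))
        (φ '' ↑(box (e + 1) (m + 1)))) (BondConfig.relabel (sym2Equiv φ.toEquiv) ω) 0 := by
      rw [h3]; exact self_mem_openClusterIn _ _ _
    exact ⟨φ.toEquiv 0, openClusterIn_mono_graph (withinGraph_mono _ himg) _ 0 h4, hφ0⟩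
  calc (bondPercolation (zdGraph (e + 1)) p).real
        {ω | x ∈ openClusterIn (withinGraph (zdGraph (e + 1)) ↑(box (e + 1) (m + 1))) ω 0}
      ≤ (bondPercolation (zdGraph (e + 1)) p).real (BondConfig.relabel (sym2Equiv φ.toEquiv) ⁻¹'
          {ω | ∃ y ∈ openClusterIn (withinGraph (zdGraph (e + 1)) (halfSpace (e + 1))) ω 0,
            y ∉ box (e + 1) m}) := measureReal_mono hsub
    _ = _ := bondPercolation_real_preimage_relabel_iso φ p _

/-! ## Continuity from above: exits of the half-space cluster from large boxes -/

/-- **`P_p(0 ↔ Λ(m)ᶜ inside ℍ) → 0`** when `θ_ℍ(p) = 0`: the events decrease in `m` to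
`{0 ↔ ∞ inside ℍ}` (a cluster meets the complement of every box iff it is infinite), whose
`P_p`-probability is `θ_ℍ(p)` (`theta_induce_eq_real_percolatesVia`). In the printed proof this is
"`P(0` is connected to infinity by a `p_c`-open path in `ℕ × ℤ^{d-1}) = 0`, so that for `n` large
enough `P(∃ γ a p_c-open path starting from 0 in ℕ × ℤ^{d-1} such that |γ| ≥ n) ≤ η`".
[cite: CerfDembin2020, §2 (proof of Thm. 1.2)] -/
theorem tendsto_real_exitBox (e : ℕ) (p : unitInterval)
    (hθ : theta (halfSpaceGraph (e + 1)) (halfSpaceOrigin (e + 1)) p = 0) :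
    Tendsto (fun m : ℕ => (bondPercolation (zdGraph (e + 1)) p).real
      {ω | ∃ y ∈ openClusterIn (withinGraph (zdGraph (e + 1)) (halfSpace (e + 1))) ω 0,
        y ∉ box (e + 1) m}) atTop (𝓝 0) := by
  set μ := bondPercolation (zdGraph (e + 1)) p with hμ
  set D : ℕ → Set (BondConfig (Site (e + 1))) := fun m =>
    {ω | ∃ y ∈ openClusterIn (withinGraph (zdGraph (e + 1)) (halfSpace (e + 1))) ω 0,
      y ∉ box (e + 1) m} with hD
  have hmeas : ∀ m, MeasurableSet (D m) := by
    intro m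
    have : D m = ⋃ y ∈ ((↑(box (e + 1) m) : Set (Site (e + 1)))ᶜ),
        openConnVia (withinGraph (zdGraph (e + 1)) (halfSpace (e + 1))) 0 y := by
      ext ω
      simp only [hD, Set.mem_setOf_eq, Set.mem_iUnion, Set.mem_compl_iff, Finset.mem_coe,
        exists_prop, openConnVia]
      exact ⟨fun ⟨y, hy, hyb⟩ => ⟨y, hyb, hy⟩, fun ⟨y, hyb, hy⟩ => ⟨y, hy, hyb⟩⟩
    rw [this]
    exact MeasurableSet.biUnion (Set.to_countable _) fun y _ => measurableSet_openConnVia _ 0 y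
  have hanti : Antitone D := fun m m' hmm' ω ⟨y, hy, hyb⟩ =>
    ⟨y, hy, fun h => hyb (box_mono _ hmm' h)⟩
  have hinter : ⋂ m, D m =
      percolatesVia (withinGraph (zdGraph (e + 1)) (halfSpace (e + 1))) 0 := by
    ext ω
    simp only [Set.mem_iInter, hD, Set.mem_setOf_eq, percolatesVia]
    constructor
    · intro h hfin
      have hdir : Directed (· ⊆ ·) fun L : ℕ => (↑(box (e + 1) L) : Set (Site (e + 1))) :=
        Monotone.directed_le fun a b hab => Finset.coe_subset.2 (box_mono _ hab)
      obtain ⟨m, hm⟩ := hdir.exists_mem_subset_of_finset_subset_biUnion (s := hfin.toFinset)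
        (by rw [iUnion_coe_box]; exact Set.subset_univ _)
      rw [Set.Finite.coe_toFinset] at hm
      obtain ⟨y, hy, hyb⟩ := h m
      exact hyb (Finset.mem_coe.1 (hm hy))
    · intro hinf m
      by_contra hcon
      push Not at hcon
      exact hinf ((finite_toSet (box (e + 1) m)).subset fun y hy => Finset.mem_coe.2 (hcon y hy))
  have hzero : μ (percolatesVia (withinGraph (zdGraph (e + 1)) (halfSpace (e + 1))) 0) = 0 := by
    have h := theta_induce_eq_real_percolatesVia (zdGraph (e + 1)) (halfSpace (e + 1))
      (0 : Site (e + 1)) (zero_mem_halfSpace (e + 1)) p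
    have h' : μ.real (percolatesVia (withinGraph (zdGraph (e + 1)) (halfSpace (e + 1))) 0) = 0 := by
      rw [hμ, ← h]; exact hθ
    exact (measureReal_eq_zero_iff (measure_ne_top μ _)).1 h'
  have ht := tendsto_measure_iInter_atTop (μ := μ) (fun m => (hmeas m).nullMeasurableSet) hanti
    ⟨0, measure_ne_top μ _⟩
  rw [hinter, hzero] at ht
  have := (ENNReal.tendsto_toReal ENNReal.zero_ne_top).comp ht
  rw [ENNReal.toReal_zero] at this
  exact this

/-! ## The first-moment bound and the null event -/

/-- Counting a doubly filtered finset as a sum of indicators (used to write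
`|𝒦_n ∩ face|` as `Σ_{x ∈ face} 𝟙{x ∈ 𝒦_n}`). [folklore] -/
theorem card_filter_filter_eq_sum {α : Type*} (s : Finset α) (P Q : α → Prop) [DecidablePred P]
    [DecidablePred Q] :
    (#((s.filter P).filter Q) : ℝ) = ∑ x ∈ s.filter Q, if P x then (1 : ℝ) else 0 := by
  have : (s.filter P).filter Q = (s.filter Q).filter P := by
    ext x; simp only [mem_filter]; tauto
  rw [this, card_filter]
  push_cast
  rfl

/-- **The event of the proof by contradiction is null.** For `c > 0`, `N ≥ 2` and `p` with
`θ_ℍ(p) = 0`, the event "for every `n ≥ N` every valid `H` with `|H| ≤ n^d` has `c|H| < n|∂°H|`"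
(i.e. `inf_{n ≥ N} n φ̂_n ≥ c`, and also `n φ̂_n > c` up to ties) has `P_p`-probability `0`:
on it `γ n^d < n X_n` for every `n ≥ N` (`boundary_lower_bound`), `X_n` the number of face
vertices of `Λ(n)` joined to `0` inside `Λ(n)`, whereas by Markov's inequality, linearity, the
symmetry bound `real_mem_boxCluster_le` and `|face| ≤ (2n+1)^{d-1}`,
`γ n^d P(γ n^d ≤ n X_n) ≤ E(n X_n) ≤ 2d 3^{d-1} n^d P(0 ↔ Λ(n-1)ᶜ in ℍ) → 0`.
[cite: CerfDembin2020, §2 (proof of Thm. 1.2, (eqabs), (eq1), (eq2))] -/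
theorem measure_bad_eq_zero (e : ℕ) (p : unitInterval)
    (hθ : theta (halfSpaceGraph (e + 1)) (halfSpaceOrigin (e + 1)) p = 0) {c : ℝ} (hc : 0 < c)
    {N : ℕ} (hN : 2 ≤ N) :
    bondPercolation (zdGraph (e + 1)) p
      {ω | ∀ n : ℕ, N ≤ n → ∀ H : Finset (Site (e + 1)), IsValidSubgraph (e + 1) ω H →
        H.card ≤ n ^ (e + 1) → c * H.card < n * openEdgeBoundaryCard (e + 1) ω H} = 0 := by
  set μ := bondPercolation (zdGraph (e + 1)) p with hμ
  obtain ⟨γ, hγ, hdet⟩ := boundary_lower_bound e hc hN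
  set Bad := {ω : BondConfig (Site (e + 1)) | ∀ n : ℕ, N ≤ n → ∀ H : Finset (Site (e + 1)),
    IsValidSubgraph (e + 1) ω H → H.card ≤ n ^ (e + 1) →
      c * H.card < n * openEdgeBoundaryCard (e + 1) ω H} with hBad
  set D : ℕ → Set (BondConfig (Site (e + 1))) := fun m =>
    {ω | ∃ y ∈ openClusterIn (withinGraph (zdGraph (e + 1)) (halfSpace (e + 1))) ω 0,
      y ∉ box (e + 1) m} with hD
  have hDlim : Tendsto (fun m => μ.real (D m)) atTop (𝓝 0) := tendsto_real_exitBox e p hθ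
  suffices hmain : ∀ m : ℕ, N ≤ m + 1 →
      γ * μ.real Bad ≤ (2 * ((e : ℝ) + 1) * 3 ^ e) * μ.real (D m) by
    have hlim : Tendsto (fun m => (2 * ((e : ℝ) + 1) * 3 ^ e) * μ.real (D m)) atTop
        (𝓝 ((2 * ((e : ℝ) + 1) * 3 ^ e) * 0)) := hDlim.const_mul _
    rw [mul_zero] at hlim
    have hle : γ * μ.real Bad ≤ 0 :=
      ge_of_tendsto hlim (Filter.eventually_atTop.2 ⟨N, fun m hm => hmain m (by omega)⟩)
    have h0 : μ.real Bad ≤ 0 := by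
      by_contra hpos
      push Not at hpos
      linarith [mul_pos hγ hpos]
    exact (measureReal_eq_zero_iff (measure_ne_top μ _)).1 (le_antisymm h0 measureReal_nonneg)
  intro m hm
  set n := m + 1 with hn
  -- the indicator-sum form of `n X_n`
  set S : Site (e + 1) → Set (BondConfig (Site (e + 1))) := fun x =>
    {ω | x ∈ openClusterIn (withinGraph (zdGraph (e + 1)) ↑(box (e + 1) n)) ω 0} with hS
  have hSmeas : ∀ x, MeasurableSet (S x) := fun x => measurableSet_openConnVia _ 0 x
  set F : Fin (e + 1) → ℤ → Finset (Site (e + 1)) := fun i v =>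
    (box (e + 1) n).filter fun x => x i = v with hF
  set f : BondConfig (Site (e + 1)) → ℝ := fun ω => (n : ℝ) * ∑ i : Fin (e + 1),
    (∑ x ∈ F i n, ((S x).indicator 1 ω : ℝ) + ∑ x ∈ F i (-(n : ℤ)), ((S x).indicator 1 ω : ℝ))
    with hf
  have hind : ∀ x ω, (S x).indicator (1 : BondConfig (Site (e + 1)) → ℝ) ω =
      if x ∈ openClusterIn (withinGraph (zdGraph (e + 1)) ↑(box (e + 1) n)) ω 0 then 1 else 0 :=
    fun x ω => by rw [Set.indicator_apply]; rfl
  have hfX : ∀ ω, f ω = n * ∑ i : Fin (e + 1),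
      ((#(((box (e + 1) n).filter fun x =>
          x ∈ openClusterIn (withinGraph (zdGraph (e + 1)) ↑(box (e + 1) n)) ω 0).filter
            fun x => x i = (n : ℤ)) : ℝ) +
        #(((box (e + 1) n).filter fun x =>
          x ∈ openClusterIn (withinGraph (zdGraph (e + 1)) ↑(box (e + 1) n)) ω 0).filter
            fun x => x i = -(n : ℤ))) := by
    intro ω
    rw [hf]
    dsimp only
    congr 1
    refine sum_congr rfl fun i _ => ?_
    rw [card_filter_filter_eq_sum, card_filter_filter_eq_sum]
    simp only [hind]
    rfl
  -- `Bad ⊆ {γ n^d ≤ f}`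
  have hsub : Bad ⊆ {ω | γ * (n : ℝ) ^ (e + 1) ≤ f ω} := fun ω hω => by
    rw [Set.mem_setOf_eq, hfX]
    exact (hdet ω hω n hm).le
  -- integrability and the integral of `f`
  have hIint : ∀ x, Integrable ((S x).indicator (1 : BondConfig (Site (e + 1)) → ℝ)) μ :=
    fun x => (integrable_const 1).indicator (hSmeas x)
  have hgint : ∀ i, Integrable (fun ω => ∑ x ∈ F i n, ((S x).indicator 1 ω : ℝ) +
      ∑ x ∈ F i (-(n : ℤ)), ((S x).indicator 1 ω : ℝ)) μ := fun i =>
    (integrable_finsetSum (F i n) fun x _ => hIint x).fun_add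
      (integrable_finsetSum (F i (-(n : ℤ))) fun x _ => hIint x)
  have hfint : Integrable f μ := (integrable_finsetSum univ fun i _ => hgint i).const_mul _
  have hfnn : 0 ≤ᵐ[μ] f := ae_of_all μ fun ω => by
    rw [hf]
    exact mul_nonneg (Nat.cast_nonneg n) (sum_nonneg fun i _ => add_nonneg
      (sum_nonneg fun x _ => Set.indicator_nonneg (fun _ _ => zero_le_one) _)
      (sum_nonneg fun x _ => Set.indicator_nonneg (fun _ _ => zero_le_one) _))
  have hintf : ∫ ω, f ω ∂μ = n * ∑ i : Fin (e + 1),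
      (∑ x ∈ F i n, μ.real (S x) + ∑ x ∈ F i (-(n : ℤ)), μ.real (S x)) := by
    rw [hf, integral_const_mul, integral_finsetSum _ fun i _ => hgint i]
    congr 1
    refine sum_congr rfl fun i _ => ?_
    rw [integral_add (integrable_finsetSum _ fun x _ => hIint x)
      (integrable_finsetSum _ fun x _ => hIint x),
      integral_finsetSum _ fun x _ => hIint x, integral_finsetSum _ fun x _ => hIint x]
    simp only [integral_indicator_one (hSmeas _)]
  -- each term is at most `P(D m)`, each face has at most `(2n+1)^e` vertices
  have hterm : ∀ i (u : ℤˣ), ∀ x ∈ F i (u * (n : ℤ)), μ.real (S x) ≤ μ.real (D m) := by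
    intro i u x hx
    rw [hF, mem_filter] at hx
    exact real_mem_boxCluster_le e m p i u (by rw [hx.2, hn])
  have hface : ∀ i (u : ℤˣ), ∑ x ∈ F i (u * (n : ℤ)), μ.real (S x) ≤ (2 * n + 1) ^ e * μ.real (D m) := by
    intro i u
    calc ∑ x ∈ F i (u * (n : ℤ)), μ.real (S x) ≤ #(F i (u * (n : ℤ))) • μ.real (D m) :=
          sum_le_card_nsmul _ _ _ (hterm i u)
      _ = #(F i (u * (n : ℤ))) * μ.real (D m) := nsmul_eq_mul _ _
      _ ≤ (2 * n + 1) ^ e * μ.real (D m) := by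
          gcongr
          exact_mod_cast card_face_le e n i _
  have hint_le : ∫ ω, f ω ∂μ ≤ 2 * ((e : ℝ) + 1) * 3 ^ e * (n : ℝ) ^ (e + 1) * μ.real (D m) := by
    rw [hintf]
    have h1 : ∀ i : Fin (e + 1), ∑ x ∈ F i n, μ.real (S x) + ∑ x ∈ F i (-(n : ℤ)), μ.real (S x) ≤
        2 * ((2 * n + 1) ^ e * μ.real (D m)) := by
      intro i
      have ha := hface i 1
      have hb := hface i (-1)
      simp only [Units.val_one, one_mul, Units.val_neg, neg_one_mul] at ha hb
      linarith
    have h2 : ∑ i : Fin (e + 1), (∑ x ∈ F i n, μ.real (S x) + ∑ x ∈ F i (-(n : ℤ)), μ.real (S x)) ≤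
        ∑ _i : Fin (e + 1), 2 * ((2 * n + 1) ^ e * μ.real (D m)) := sum_le_sum fun i _ => h1 i
    rw [sum_const, card_univ, Fintype.card_fin, nsmul_eq_mul] at h2
    have hn1 : (1 : ℝ) ≤ n := by rw [hn]; push_cast; linarith
    have h3 : ((2 : ℝ) * n + 1) ^ e ≤ (3 * n) ^ e := pow_le_pow_left₀ (by positivity) (by linarith) e
    have hD0 : 0 ≤ μ.real (D m) := measureReal_nonneg
    calc (n : ℝ) * ∑ i : Fin (e + 1), (∑ x ∈ F i n, μ.real (S x) + ∑ x ∈ F i (-(n : ℤ)), μ.real (S x))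
        ≤ n * (↑(e + 1) * (2 * ((2 * n + 1) ^ e * μ.real (D m)))) := by gcongr
      _ ≤ n * (↑(e + 1) * (2 * ((3 * n) ^ e * μ.real (D m)))) := by gcongr
      _ = 2 * ((e : ℝ) + 1) * 3 ^ e * (n : ℝ) ^ (e + 1) * μ.real (D m) := by push_cast; ring
  -- Markov
  have hmarkov := mul_meas_ge_le_integral_of_nonneg hfnn hfint (γ * (n : ℝ) ^ (e + 1))
  have hnpos : (0 : ℝ) < (n : ℝ) ^ (e + 1) := by positivity
  have key : γ * (n : ℝ) ^ (e + 1) * μ.real Bad ≤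
      2 * ((e : ℝ) + 1) * 3 ^ e * (n : ℝ) ^ (e + 1) * μ.real (D m) :=
    calc γ * (n : ℝ) ^ (e + 1) * μ.real Bad
        ≤ γ * (n : ℝ) ^ (e + 1) * μ.real {ω | γ * (n : ℝ) ^ (e + 1) ≤ f ω} :=
          mul_le_mul_of_nonneg_left (measureReal_mono hsub (measure_ne_top μ _)) (by positivity)
      _ ≤ ∫ ω, f ω ∂μ := hmarkov
      _ ≤ _ := hint_le
  have key' : (γ * μ.real Bad) * (n : ℝ) ^ (e + 1) ≤
      ((2 * ((e : ℝ) + 1) * 3 ^ e) * μ.real (D m)) * (n : ℝ) ^ (e + 1) := by linarith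
  exact le_of_mul_le_mul_right key' hnpos

/-! ## Theorem 1.2 from `θ_ℍ(p) = 0` -/

/-- **Cerf–Dembin 2020, Theorem 1.2, for every density at which the half-space does not
percolate.** If `θ_ℍ(p) = 0` on `ℤ^{e+1}`, then `P_p`-a.s., for every `c > 0` and `N` there are
`n ≥ N` and a valid subgraph `H` of `𝒞(0)` with `|H| ≤ n^{e+1}` and `n |∂°H| ≤ c |H|`
(`liminf_n n φ̂_n = 0`). The exceptional set is the countable union over `c = 1/(k+1)` and `N` of the
null events of `measure_bad_eq_zero`. [cite: CerfDembin2020, Thm. 1.2 (proof, §2)] -/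
theorem ae_vanishing_of_theta_halfSpace (e : ℕ) (p : unitInterval)
    (hθ : theta (halfSpaceGraph (e + 1)) (halfSpaceOrigin (e + 1)) p = 0) :
    ∀ᵐ ω ∂(bondPercolation (zdGraph (e + 1)) p),
      ∀ c : ℝ, 0 < c → ∀ N : ℕ, ∃ n : ℕ, N ≤ n ∧ ∃ H : Finset (Site (e + 1)),
        IsValidSubgraph (e + 1) ω H ∧ H.card ≤ n ^ (e + 1) ∧
        (n : ℝ) * (openEdgeBoundaryCard (e + 1) ω H : ℝ) ≤ c * H.card := by
  have key : ∀ k N : ℕ, ∀ᵐ ω ∂(bondPercolation (zdGraph (e + 1)) p),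
      ∃ n : ℕ, N + 2 ≤ n ∧ ∃ H : Finset (Site (e + 1)),
        IsValidSubgraph (e + 1) ω H ∧ H.card ≤ n ^ (e + 1) ∧
        (n : ℝ) * (openEdgeBoundaryCard (e + 1) ω H : ℝ) ≤ (1 / ((k : ℝ) + 1)) * H.card := by
    intro k N
    rw [ae_iff]
    refine measure_mono_null ?_
      (measure_bad_eq_zero e p hθ (c := 1 / ((k : ℝ) + 1)) (by positivity) (N := N + 2) (by omega))
    intro ω hω
    simp only [Set.mem_setOf_eq] at hω ⊢
    push Not at hω
    exact hω
  have key' : ∀ᵐ ω ∂(bondPercolation (zdGraph (e + 1)) p), ∀ k N : ℕ,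
      ∃ n : ℕ, N + 2 ≤ n ∧ ∃ H : Finset (Site (e + 1)),
        IsValidSubgraph (e + 1) ω H ∧ H.card ≤ n ^ (e + 1) ∧
        (n : ℝ) * (openEdgeBoundaryCard (e + 1) ω H : ℝ) ≤ (1 / ((k : ℝ) + 1)) * H.card := by
    rw [ae_all_iff]; intro k; rw [ae_all_iff]; exact key k
  filter_upwards [key'] with ω hω c hc N
  obtain ⟨k, hk⟩ := exists_nat_one_div_lt hc
  obtain ⟨n, hn, H, hH, hcard, hb⟩ := hω k N
  exact ⟨n, by omega, H, hH, hcard,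
    hb.trans (mul_le_mul_of_nonneg_right hk.le (Nat.cast_nonneg _))⟩

end CerfDembin

/-! ## Theorem 1.2 on `ℤ²` and `ℤ³`, unconditionally -/

/-- **Cerf–Dembin 2020, Theorem 1.2 on `ℤ²`** (unconditional: `θ_ℍ(p_c(ℤ²)) = 0` by Harris–Kesten,
the tree's `BarskyGrimmettNewman1991_dim_two`): `P_{p_c}`-a.s., for every `c > 0` and `N` there
are `n ≥ N` and a valid `H ⊆ 𝒞(0)` with `|H| ≤ n²` and `n |∂°H| ≤ c |H|` (the case `d = 2` of
`CerfDembin2020_thm12`). [cite: CerfDembin2020, Thm. 1.2] -/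
theorem CerfDembin2020_thm12_dim_two :
    ∀ᵐ ω ∂(bondPercolation (zdGraph 2) (criticalProbI 2)),
      ∀ c : ℝ, 0 < c → ∀ N : ℕ, ∃ n : ℕ, N ≤ n ∧ ∃ H : Finset (Site 2),
        IsValidSubgraph 2 ω H ∧ H.card ≤ n ^ 2 ∧
        (n : ℝ) * (openEdgeBoundaryCard 2 ω H : ℝ) ≤ c * H.card :=
  CerfDembin.ae_vanishing_of_theta_halfSpace 1 _ BarskyGrimmettNewman1991_dim_two

/-- **Cerf–Dembin 2020, Theorem 1.2 on `ℤ³`** (unconditional: `θ_ℍ(p_c(ℤ³)) = 0` is the tree's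
proved `BarskyGrimmettNewman1991_Z3_holds`): `P_{p_c}`-a.s., for every `c > 0` and `N` there are
`n ≥ N` and a valid `H ⊆ 𝒞(0)` with `|H| ≤ n³` and `n |∂°H| ≤ c |H|` (the case `d = 3` of
`CerfDembin2020_thm12`, the one used towards `θ(p_c) = 0` on `ℤ³`). [cite: CerfDembin2020, Thm. 1.2] -/
theorem CerfDembin2020_thm12_dim_three :
    ∀ᵐ ω ∂(bondPercolation (zdGraph 3) (criticalProbI 3)),
      ∀ c : ℝ, 0 < c → ∀ N : ℕ, ∃ n : ℕ, N ≤ n ∧ ∃ H : Finset (Site 3),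
        IsValidSubgraph 3 ω H ∧ H.card ≤ n ^ 3 ∧
        (n : ℝ) * (openEdgeBoundaryCard 3 ω H : ℝ) ≤ c * H.card :=
  CerfDembin.ae_vanishing_of_theta_halfSpace 2 _ BarskyGrimmettNewman1991_Z3_holds

/-- `CerfDembin2020_thm12` restricted to the dimensions `d ≤ 3`, unconditionally.
[cite: CerfDembin2020, Thm. 1.2] -/
theorem CerfDembin2020_thm12_of_le_three (d : ℕ) (hd : 2 ≤ d) (hd3 : d ≤ 3) :
    ∀ᵐ ω ∂(bondPercolation (zdGraph d) (criticalProbI d)),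
      ∀ c : ℝ, 0 < c → ∀ N : ℕ, ∃ n : ℕ, N ≤ n ∧ ∃ H : Finset (Site d),
        IsValidSubgraph d ω H ∧ H.card ≤ n ^ d ∧
        (n : ℝ) * (openEdgeBoundaryCard d ω H : ℝ) ≤ c * H.card := by
  interval_cases d
  · exact CerfDembin2020_thm12_dim_two
  · exact CerfDembin2020_thm12_dim_three

end Literature.Probability.Percolation
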